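import Mathlib

/-!
# Generic algebra for the cubic-Casimir stub of `QuarticGate` (line `axis-sectors`)

Folklore (multi)linear algebra consumed by `stub_noAxialCubicCasimir` (crux
`stmt-AnomalousDissipation-11464`); pure Mathlib, no definitions.

* (A) EULER/TAYLOR IDENTITIES FOR A HOMOGENEOUS CUBIC `P` over a field of characteristic zero,
  with `h i j k := coeff 0 (∂ᵢ ∂ⱼ ∂ₖ P)` (a symmetric tensor, `∂ᵢ ∂ⱼ ∂ₖ P = C (h i j k)`):
  `P(x) = (1/6) Σ h i j k xᵢ xⱼ xₖ` and `∂ᵢP(x) = (1/2) Σ h i j k xⱼ xₖ`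
  (`eval_eq_sum_of_isHomogeneous_three`, `eval_pderiv_eq_sum_of_isHomogeneous_three`), from
  Mathlib's Euler identity `MvPolynomial.IsHomogeneous.sum_X_mul_pderiv` in degrees `3, 2, 1`.
* (B) POLARISATION OF A MULTILINEAR FORM `Λ` in finitely many arguments indexed by `ι`:
  `Σ_{σ ∈ Perm ι} Λ (c ∘ σ) = Σ_{s ⊆ ι} (-1)^{|sᶜ|} Λ (Σ_{j∈s} cⱼ, …, Σ_{j∈s} cⱼ)`
  (`sum_perm_multilinear_eq_sum_sign_smul_diag`: `MultilinearMap.map_sum_finset` plus the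
  inclusion–exclusion sum `Σ_{u ⊆ M} (-1)^{|u|} = [M = ∅]`); hence a multilinear form vanishing on
  the diagonal has vanishing symmetrisation (`sum_perm_multilinear_eq_zero_of_forall_diag`), the
  explicit sum over `S₄` (`sum_perm_fin_four`), and the PAIRING FORM
  `Φ(E c c, c, c) ≡ 0 ⇒ Σ_{pairings} Φ(E cₐ c_b, c_c, c_d) = 0` for `E` symmetric bilinear and `Φ`
  trilinear symmetric in its last two slots (`pairing_polarization_of_diag_eq_zero`).
* (C) A COMPLEX POLYNOMIAL VANISHING AT ALL REAL POINTS IS ZERO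
  (`eq_zero_of_forall_eval_ofReal_eq_zero`): split the coefficients into real and imaginary
  parts and apply `MvPolynomial.funext` over `ℝ`.
-/

namespace Summit.AnomalousDissipation.AnomalousDissipation.Theorems.MomentParityQuarticGate

-- the problem directory repeats the summit name, so the namespace legitimately has a duplicate
set_option linter.dupNamespace false

open MvPolynomial Finset

/-! ## (A) Euler/Taylor identities for a homogeneous cubic -/

section Cubic

/-- Partial derivatives of polynomials commute: `∂ᵢ ∂ⱼ p = ∂ⱼ ∂ᵢ p` (any commutative
semiring of coefficients, any index type). [folklore] -/
theorem pderiv_pderiv_swap {R : Type*} [CommSemiring R] {σ : Type*} (i j : σ)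
    (p : MvPolynomial σ R) : pderiv i (pderiv j p) = pderiv j (pderiv i p) := by
  classical
  induction p using MvPolynomial.induction_on with
  | C a => simp
  | add p q hp hq => simp [map_add, hp, hq]
  | mul_X p k h =>
    simp only [pderiv_mul, map_add, h, pderiv_X]
    by_cases hik : i = k <;> by_cases hjk : j = k <;> simp [hik, hjk]

/-- The third partials `∂ᵢ ∂ⱼ ∂ₖ P` are symmetric under swapping the two outer indices
`i, k` (hence, with `pderiv_pderiv_swap`, under all permutations of `i, j, k`). [folklore] -/
theorem pderiv_pderiv_pderiv_reverse {R : Type*} [CommSemiring R] {σ : Type*} (i j k : σ)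
    (P : MvPolynomial σ R) :
    pderiv i (pderiv j (pderiv k P)) = pderiv k (pderiv j (pderiv i P)) := by
  rw [pderiv_pderiv_swap j k, pderiv_pderiv_swap i k, pderiv_pderiv_swap i j]

/-- For `P` homogeneous of degree `3`, each third partial `∂ᵢ ∂ⱼ ∂ₖ P` is the constant
polynomial `C (h i j k)` with `h i j k := coeff 0 (∂ᵢ ∂ⱼ ∂ₖ P)`. [folklore] -/
theorem pderiv_pderiv_pderiv_eq_C_of_isHomogeneous_three {R : Type*} [CommSemiring R]
    {σ : Type*} {P : MvPolynomial σ R} (hP : P.IsHomogeneous 3) (i j k : σ) :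
    pderiv i (pderiv j (pderiv k P)) = C (coeff 0 (pderiv i (pderiv j (pderiv k P)))) := by
  have h0 : (pderiv i (pderiv j (pderiv k P))).IsHomogeneous 0 := hP.pderiv.pderiv.pderiv
  rwa [← totalDegree_zero_iff_isHomogeneous, totalDegree_eq_zero_iff_eq_C] at h0

/-- The cubic coefficient tensor `coeff 0 (∂ᵢ ∂ⱼ ∂ₖ P)` is symmetric in `i, j`. [folklore] -/
theorem coeff_pderiv_pderiv_pderiv_swap_left {R : Type*} [CommSemiring R] {σ : Type*}
    (P : MvPolynomial σ R) (i j k : σ) :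
    coeff 0 (pderiv i (pderiv j (pderiv k P))) = coeff 0 (pderiv j (pderiv i (pderiv k P))) := by
  rw [pderiv_pderiv_swap i j]

/-- The cubic coefficient tensor `coeff 0 (∂ᵢ ∂ⱼ ∂ₖ P)` is symmetric in `j, k`. [folklore] -/
theorem coeff_pderiv_pderiv_pderiv_swap_right {R : Type*} [CommSemiring R] {σ : Type*}
    (P : MvPolynomial σ R) (i j k : σ) :
    coeff 0 (pderiv i (pderiv j (pderiv k P))) = coeff 0 (pderiv i (pderiv k (pderiv j P))) := by
  rw [pderiv_pderiv_swap j k]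

/-- The cubic coefficient tensor `coeff 0 (∂ᵢ ∂ⱼ ∂ₖ P)` is symmetric in `i, k`. [folklore] -/
theorem coeff_pderiv_pderiv_pderiv_reverse {R : Type*} [CommSemiring R] {σ : Type*}
    (P : MvPolynomial σ R) (i j k : σ) :
    coeff 0 (pderiv i (pderiv j (pderiv k P))) = coeff 0 (pderiv k (pderiv j (pderiv i P))) := by
  rw [pderiv_pderiv_pderiv_reverse]

/-- **Taylor/Euler identity for the gradient of a homogeneous cubic.** If `P` is homogeneous of
degree `3` over a field of characteristic zero then, with `h i j k := coeff 0 (∂ᵢ ∂ⱼ ∂ₖ P)`,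
`∂ᵢ P (x) = (1/2) Σⱼ Σₖ h i j k · xⱼ xₖ` for every point `x`. Proof: Euler's identity
(`MvPolynomial.IsHomogeneous.sum_X_mul_pderiv`) for `∂ᵢ P` (degree `2`) and for `∂ⱼ ∂ᵢ P`
(degree `1`), and `∂ₖ ∂ⱼ ∂ᵢ P = C (h i j k)`. [folklore] -/
theorem eval_pderiv_eq_sum_of_isHomogeneous_three :
    ∀ {K : Type} [Field K] [CharZero K] {σ : Type} [Fintype σ] {P : MvPolynomial σ K},
      P.IsHomogeneous 3 → ∀ (x : σ → K) (i : σ), MvPolynomial.eval x (MvPolynomial.pderiv i P) =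
        (1 / 2 : K) * ∑ j, ∑ k, MvPolynomial.coeff 0 (MvPolynomial.pderiv i (MvPolynomial.pderiv j
          (MvPolynomial.pderiv k P))) * x j * x k := by
  intro K _ _ σ _ P hP x i
  have h2 : (pderiv i P).IsHomogeneous 2 := hP.pderiv
  have h1 : ∀ j, (pderiv j (pderiv i P)).IsHomogeneous 1 := fun j => h2.pderiv
  -- `∂ⱼ ∂ᵢ P = Σₖ Xₖ · h i j k`
  have hlin : ∀ j, MvPolynomial.eval x (pderiv j (pderiv i P)) =
      ∑ k, coeff 0 (pderiv i (pderiv j (pderiv k P))) * x k := by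
    intro j
    have hE := (h1 j).sum_X_mul_pderiv
    rw [one_smul] at hE
    rw [← hE, map_sum]
    refine Finset.sum_congr rfl fun k _ => ?_
    rw [← pderiv_pderiv_pderiv_reverse i j k P,
      pderiv_pderiv_pderiv_eq_C_of_isHomogeneous_three hP i j k, coeff_zero_C, map_mul, eval_X,
      eval_C]
    exact mul_comm _ _
  -- `2 ∂ᵢ P = Σⱼ Xⱼ ∂ⱼ ∂ᵢ P`
  have h2eval : (2 : K) * MvPolynomial.eval x (pderiv i P) =
      ∑ j, x j * ∑ k, coeff 0 (pderiv i (pderiv j (pderiv k P))) * x k := by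
    have := congrArg (MvPolynomial.eval x) h2.sum_X_mul_pderiv
    rw [map_nsmul, nsmul_eq_mul, Nat.cast_ofNat, map_sum] at this
    rw [← this]
    refine Finset.sum_congr rfl fun j _ => ?_
    rw [map_mul, eval_X, hlin]
  rw [show MvPolynomial.eval x (pderiv i P) = (1 / 2 : K) * ((2 : K) * MvPolynomial.eval x
      (pderiv i P)) by field_simp, h2eval]
  simp only [Finset.mul_sum]
  refine Finset.sum_congr rfl fun j _ => Finset.sum_congr rfl fun k _ => ?_
  ring

/-- **Taylor/Euler identity for a homogeneous cubic.** If `P` is homogeneous of degree `3` over a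
field of characteristic zero then, with `h i j k := coeff 0 (∂ᵢ ∂ⱼ ∂ₖ P)`,
`P (x) = (1/6) Σᵢ Σⱼ Σₖ h i j k · xᵢ xⱼ xₖ` for every point `x` (Euler's identity
`Σᵢ Xᵢ ∂ᵢ P = 3 P` combined with `eval_pderiv_eq_sum_of_isHomogeneous_three`). [folklore] -/
theorem eval_eq_sum_of_isHomogeneous_three :
    ∀ {K : Type} [Field K] [CharZero K] {σ : Type} [Fintype σ] {P : MvPolynomial σ K},
      P.IsHomogeneous 3 → ∀ x : σ → K, MvPolynomial.eval x P = (1 / 6 : K) * ∑ i, ∑ j, ∑ k,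
        MvPolynomial.coeff 0 (MvPolynomial.pderiv i (MvPolynomial.pderiv j
          (MvPolynomial.pderiv k P))) * x i * x j * x k := by
  intro K _ _ σ _ P hP x
  have hE3 := congrArg (MvPolynomial.eval x) hP.sum_X_mul_pderiv
  rw [map_nsmul, nsmul_eq_mul, Nat.cast_ofNat, map_sum] at hE3
  have h3 : (3 : K) * MvPolynomial.eval x P = ∑ i, x i * ((1 / 2 : K) *
      ∑ j, ∑ k, coeff 0 (pderiv i (pderiv j (pderiv k P))) * x j * x k) := by
    rw [← hE3]
    refine Finset.sum_congr rfl fun i _ => ?_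
    rw [map_mul, eval_X, eval_pderiv_eq_sum_of_isHomogeneous_three hP]
  rw [show MvPolynomial.eval x P = (1 / 3 : K) * ((3 : K) * MvPolynomial.eval x P) by
    field_simp, h3]
  simp only [Finset.mul_sum]
  refine Finset.sum_congr rfl fun i _ => Finset.sum_congr rfl fun j _ =>
    Finset.sum_congr rfl fun k _ => ?_
  ring

end Cubic

/-! ## (B) Polarisation of multilinear forms -/

section Polarization

variable {R : Type*} [CommRing R] {ι V W : Type*} [Fintype ι] [DecidableEq ι]
  [AddCommGroup V] [Module R V] [AddCommGroup W] [Module R W]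

/-- **Inclusion–exclusion weight of an index map.** For `r : ι → ι` on a finite type,
`Σ_{s ⊇ range r} (-1)^{|sᶜ|} = [r is bijective]`: substituting `s = uᶜ` this is
`Σ_{u ⊆ (range r)ᶜ} (-1)^{|u|}`, which is `1` if `range r = ι` and `0` otherwise
(`Finset.sum_powerset_neg_one_pow_card`), and a surjective self-map of a finite type is
bijective. [folklore] -/
theorem sum_ite_forall_mem_neg_one_pow_card_compl (r : ι → ι) :
    (∑ s : Finset ι, if ∀ i, r i ∈ s then (-1 : R) ^ sᶜ.card else 0) =
      if Function.Bijective r then 1 else 0 := by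
  -- reindex by complements
  have h1 : (∑ s : Finset ι, if ∀ i, r i ∈ s then (-1 : R) ^ sᶜ.card else 0) =
      ∑ u : Finset ι, if ∀ i, r i ∉ u then (-1 : R) ^ u.card else 0 :=
    Fintype.sum_bijective _ compl_bijective _ _ fun s => by simp
  -- the condition `∀ i, r i ∉ u` says `u ⊆ (range r)ᶜ`
  have h2 : (∑ u : Finset ι, if ∀ i, r i ∉ u then (-1 : R) ^ u.card else 0) =
      ∑ u ∈ ((Finset.univ.image r)ᶜ).powerset, (-1 : R) ^ u.card := by
    rw [← Finset.sum_filter]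
    congr 1
    ext u
    simp only [Finset.mem_filter, Finset.mem_univ, true_and, Finset.mem_powerset,
      Finset.subset_iff, Finset.mem_compl, Finset.mem_image, not_exists]
    exact ⟨fun h a ha i hi => h i (hi ▸ ha), fun h i hi => h hi i rfl⟩
  have h3 : (∑ u ∈ ((Finset.univ.image r)ᶜ).powerset, (-1 : R) ^ u.card) =
      if (Finset.univ.image r)ᶜ = ∅ then 1 else 0 := by
    have := congrArg (Int.cast : ℤ → R)
      (Finset.sum_powerset_neg_one_pow_card (x := (Finset.univ.image r)ᶜ))
    push_cast at this
    rw [this]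
  have h4 : (Finset.univ.image r)ᶜ = ∅ ↔ Function.Bijective r := by
    rw [Finset.compl_eq_empty_iff, ← Finite.surjective_iff_bijective,
      Finset.eq_univ_iff_forall]
    simp only [Finset.mem_image, Finset.mem_univ, true_and]
    rfl
  rw [h1, h2, h3]
  by_cases hb : Function.Bijective r
  · rw [if_pos hb, if_pos (h4.mpr hb)]
  · rw [if_neg hb, if_neg (mt h4.mp hb)]

/-- **Polarisation identity for multilinear maps.** For a multilinear map `Λ` in finitely many
arguments (all in the same module `V`, indexed by `ι`) and any `c : ι → V`,
`Σ_{σ ∈ Perm ι} Λ (c ∘ σ) = Σ_{s ⊆ ι} (-1)^{|sᶜ|} • Λ (Σ_{j ∈ s} cⱼ, …, Σ_{j ∈ s} cⱼ)` — the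
top finite difference of the diagonal restriction `v ↦ Λ (v, …, v)` is the symmetrisation of `Λ`.
Proof: expand each diagonal value with `MultilinearMap.map_sum_finset` into a sum over index maps
`r : ι → s` and collect, for each `r : ι → ι`, the weight
`sum_ite_forall_mem_neg_one_pow_card_compl r = [r bijective]`. [folklore] -/
theorem sum_perm_multilinear_eq_sum_sign_smul_diag (Λ : MultilinearMap R (fun _ : ι => V) W)
    (c : ι → V) :
    ∑ σ : Equiv.Perm ι, Λ (fun i => c (σ i)) =
      ∑ s : Finset ι, (-1 : R) ^ sᶜ.card • Λ (fun _ => ∑ j ∈ s, c j) := by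
  -- expand each diagonal value by multilinearity
  have hexp : ∀ s : Finset ι, Λ (fun _ => ∑ j ∈ s, c j) =
      ∑ r : ι → ι, if ∀ i, r i ∈ s then Λ (fun i => c (r i)) else 0 := by
    intro s
    rw [Λ.map_sum_finset (fun _ j => c j) fun _ => s, ← Finset.sum_filter]
    congr 1
    ext r
    simp [Fintype.mem_piFinset]
  -- the permutation sum as a sum over all bijective maps
  have hperm : ∑ σ : Equiv.Perm ι, Λ (fun i => c (σ i)) =
      ∑ r : ι → ι, if Function.Bijective r then Λ (fun i => c (r i)) else 0 := by
    rw [← Finset.sum_filter]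
    exact Finset.sum_bij' (fun σ _ => (σ : ι → ι))
      (fun r hr => Equiv.ofBijective r (Finset.mem_filter.1 hr).2) (by simp)
      (by simp) (by intros; ext; simp) (by intros; rfl) (by simp)
  rw [hperm]
  simp_rw [hexp, Finset.smul_sum, smul_ite, smul_zero]
  rw [Finset.sum_comm]
  refine Finset.sum_congr rfl fun r _ => ?_
  have : (∑ s : Finset ι,
      if ∀ i, r i ∈ s then (-1 : R) ^ sᶜ.card • Λ (fun i => c (r i)) else 0) =
      (∑ s : Finset ι, if ∀ i, r i ∈ s then (-1 : R) ^ sᶜ.card else 0) • Λ (fun i => c (r i)) := by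
    rw [Finset.sum_smul]
    refine Finset.sum_congr rfl fun s _ => ?_
    split_ifs <;> simp
  rw [this, sum_ite_forall_mem_neg_one_pow_card_compl]
  split_ifs <;> simp

/-- **A multilinear form vanishing on the diagonal has vanishing symmetrisation**: if
`Λ (v, …, v) = 0` for all `v` then `Σ_{σ ∈ Perm ι} Λ (c ∘ σ) = 0` for every `c : ι → V`
(immediate from `sum_perm_multilinear_eq_sum_sign_smul_diag`). [folklore] -/
theorem sum_perm_multilinear_eq_zero_of_forall_diag :
    ∀ {R : Type} [CommRing R] {ι V W : Type} [Fintype ι] [DecidableEq ι] [AddCommGroup V]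
      [Module R V] [AddCommGroup W] [Module R W] (Λ : MultilinearMap R (fun _ : ι => V) W),
      (∀ v : V, Λ (fun _ => v) = 0) → ∀ c : ι → V,
        ∑ σ : Equiv.Perm ι, Λ (fun i => c (σ i)) = 0 := by
  intro R _ ι V W _ _ _ _ _ _ Λ hΛ c
  rw [sum_perm_multilinear_eq_sum_sign_smul_diag]
  exact Finset.sum_eq_zero fun s _ => by rw [hΛ, smul_zero]

end Polarization

section PermFour

/-- **The sum over `S₄`, explicitly**: `Σ_{σ ∈ Perm (Fin 4)} F (σ 0) (σ 1) (σ 2) (σ 3)` is the sum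
of `F i j k l` over the `24` arrangements `(i, j, k, l)` of `0, 1, 2, 3` (unfolded with
`Equiv.Perm.decomposeFin`). [folklore] -/
theorem sum_perm_fin_four {M : Type*} [AddCommMonoid M] (F : Fin 4 → Fin 4 → Fin 4 → Fin 4 → M) :
    ∑ σ : Equiv.Perm (Fin 4), F (σ 0) (σ 1) (σ 2) (σ 3) =
      F 0 1 2 3 + F 0 1 3 2 + F 0 2 1 3 + F 0 2 3 1 + F 0 3 1 2 + F 0 3 2 1
      + F 1 0 2 3 + F 1 0 3 2 + F 1 2 0 3 + F 1 2 3 0 + F 1 3 0 2 + F 1 3 2 0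
      + F 2 0 1 3 + F 2 0 3 1 + F 2 1 0 3 + F 2 1 3 0 + F 2 3 0 1 + F 2 3 1 0
      + F 3 0 1 2 + F 3 0 2 1 + F 3 1 0 2 + F 3 1 2 0 + F 3 2 0 1 + F 3 2 1 0 := by
  have e2 : ∀ σ : Equiv.Perm (Fin 4), F (σ 0) (σ 1) (σ 2) (σ 3) =
      F (σ 0) (σ 1) (σ (Fin.succ 1)) (σ (Fin.succ (Fin.succ 1))) := fun σ => rfl
  simp only [e2, Finset.univ_perm_fin_succ, Finset.sum_map, Equiv.toEmbedding_apply,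
    Fintype.sum_prod_type, Fintype.sum_unique, Fin.sum_univ_four, Fin.sum_univ_three,
    Fin.sum_univ_two]
  simp only [Equiv.Perm.decomposeFin_symm_apply_zero, Equiv.Perm.decomposeFin_symm_apply_one,
    Equiv.Perm.decomposeFin_symm_apply_succ]
  simp only [Fin.default_eq_zero, Fin.succ_zero_eq_one, Fin.succ_one_eq_two, Fin.reduceSucc,
    Equiv.swap_apply_def, Fin.reduceEq, if_true, if_false, Fin.isValue]
  abel

end PermFour

section Pairing

/-- **Polarisation, pairing form.** Let `E : V × V → V` be symmetric bilinear and `Φ` trilinear on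
`V`, symmetric in its last two arguments, over a field of characteristic zero. If the quartic
`c ↦ Φ(E c c, c, c)` vanishes identically then so does its full polarisation:
`Φ(E c₁ c₂, c₃, c₄) + Φ(E c₁ c₃, c₂, c₄) + Φ(E c₁ c₄, c₂, c₃) + Φ(E c₂ c₃, c₁, c₄)
 + Φ(E c₂ c₄, c₁, c₃) + Φ(E c₃ c₄, c₁, c₂) = 0`.
Proof: apply `sum_perm_multilinear_eq_zero_of_forall_diag` to the `4`-linear map
`m ↦ Φ(E (m 0) (m 1), m 2, m 3)`; by the symmetries its `24`-term symmetrisation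
(`sum_perm_fin_four`) is `4` times the six-term sum. [folklore] -/
theorem pairing_polarization_of_diag_eq_zero :
    ∀ {K : Type} [Field K] [CharZero K] {V : Type} [AddCommGroup V] [Module K V]
      (E : V →ₗ[K] V →ₗ[K] V) (Φ : MultilinearMap K (fun _ : Fin 3 => V) K),
      (∀ x y, E x y = E y x) → (∀ x y z, Φ ![x, y, z] = Φ ![x, z, y]) →
      (∀ c, Φ ![E c c, c, c] = 0) → ∀ c₁ c₂ c₃ c₄ : V,
        Φ ![E c₁ c₂, c₃, c₄] + Φ ![E c₁ c₃, c₂, c₄] + Φ ![E c₁ c₄, c₂, c₃] + Φ ![E c₂ c₃, c₁, c₄]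
          + Φ ![E c₂ c₄, c₁, c₃] + Φ ![E c₃ c₄, c₁, c₂] = 0 := by
  intro K _ _ V _ _ E Φ hE hΦ h0 c₁ c₂ c₃ c₄
  classical
  -- slot-wise additivity / homogeneity of `Φ ![·, ·, ·]`
  have hadd0 : ∀ a b p q, Φ ![a + b, p, q] = Φ ![a, p, q] + Φ ![b, p, q] :=
    fun a b p q => Φ.cons_add ![p, q] a b
  have hsmul0 : ∀ (t : K) a p q, Φ ![t • a, p, q] = t • Φ ![a, p, q] :=
    fun t a p q => Φ.cons_smul ![p, q] t a
  have hadd1 : ∀ a p q r, Φ ![a, p + q, r] = Φ ![a, p, r] + Φ ![a, q, r] :=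
    fun a p q r => (Φ.curryLeft a).cons_add ![r] p q
  have hsmul1 : ∀ (t : K) a p r, Φ ![a, t • p, r] = t • Φ ![a, p, r] :=
    fun t a p r => (Φ.curryLeft a).cons_smul ![r] t p
  have hadd2 : ∀ a p q r, Φ ![a, p, q + r] = Φ ![a, p, q] + Φ ![a, p, r] := by
    intro a p q r; rw [hΦ, hadd1, hΦ a q p, hΦ a r p]
  have hsmul2 : ∀ (t : K) a p q, Φ ![a, p, t • q] = t • Φ ![a, p, q] := by
    intro t a p q; rw [hΦ, hsmul1, hΦ]
  -- the 4-linear map `Λ m := Φ ![E (m 0) (m 1), m 2, m 3]`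
  let Λ : MultilinearMap K (fun _ : Fin 4 => V) K :=
    { toFun := fun m => Φ ![E (m 0) (m 1), m 2, m 3]
      map_update_add' := by
        intro inst m i x y
        obtain rfl : inst = instDecidableEqFin 4 := Subsingleton.elim _ _
        fin_cases i <;> simp [hadd0, hadd1, hadd2, map_add, LinearMap.add_apply]
      map_update_smul' := by
        intro inst m i t x
        obtain rfl : inst = instDecidableEqFin 4 := Subsingleton.elim _ _
        fin_cases i <;> simp [hsmul0, hsmul1, hsmul2, map_smul, LinearMap.smul_apply] }
  have hΛ : ∀ m : Fin 4 → V, Λ m = Φ ![E (m 0) (m 1), m 2, m 3] := fun m => rfl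
  have hsum := sum_perm_multilinear_eq_zero_of_forall_diag Λ (fun v => h0 v) ![c₁, c₂, c₃, c₄]
  simp only [hΛ] at hsum
  rw [sum_perm_fin_four (fun i j k l =>
    Φ ![E (![c₁, c₂, c₃, c₄] i) (![c₁, c₂, c₃, c₄] j), ![c₁, c₂, c₃, c₄] k, ![c₁, c₂, c₃, c₄] l])]
    at hsum
  simp only [Matrix.cons_val_zero, Matrix.cons_val_one, Matrix.cons_val] at hsum
  -- normalise with the symmetries of `E` and `Φ`: the 24 terms are 4 copies of the 6 pairings
  simp only [hE c₂ c₁, hE c₃ c₁, hE c₄ c₁, hE c₃ c₂, hE c₄ c₂, hE c₄ c₃, hΦ _ c₂ c₁, hΦ _ c₃ c₁,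
    hΦ _ c₄ c₁, hΦ _ c₃ c₂, hΦ _ c₄ c₂, hΦ _ c₄ c₃] at hsum
  linear_combination (1 / 4 : K) * hsum

end Pairing

/-! ## (C) A complex polynomial vanishing at all real points vanishes -/

section RealPoints

/-- **A complex polynomial vanishing at every real point is zero.** If `Q ∈ ℂ[Xᵢ : i ∈ σ]`
satisfies `Q(x) = 0` for all `x : σ → ℝ` then `Q = 0`. Proof: the real and imaginary parts of
the coefficients give real polynomials `Qᵣ, Qᵢ` with `Q(x) = Qᵣ(x) + i Qᵢ(x)` at real points, so
both vanish identically on `ℝ^σ`, hence are zero (`MvPolynomial.funext`, as `ℝ` is infinite).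
[folklore] -/
theorem eq_zero_of_forall_eval_ofReal_eq_zero :
    ∀ {σ : Type} (Q : MvPolynomial σ ℂ),
      (∀ x : σ → ℝ, MvPolynomial.eval (fun i => (x i : ℂ)) Q = 0) → Q = 0 := by
  intro σ Q h
  classical
  -- evaluation at a real point, coefficientwise
  have hevalC : ∀ x : σ → ℝ, MvPolynomial.eval (fun i => (x i : ℂ)) Q =
      ∑ e ∈ Q.support, Q.coeff e * ((e.prod fun i n => x i ^ n : ℝ) : ℂ) := by
    intro x
    conv_lhs => rw [Q.as_sum]
    rw [map_sum]
    refine Finset.sum_congr rfl fun e _ => ?_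
    rw [eval_monomial, Finsupp.prod, Finsupp.prod]
    push_cast
    rfl
  -- the real polynomial with coefficients `f (Q.coeff e)` for an `ℝ`-linear `f = re, im`
  have hpart : ∀ f : ℂ →ₗ[ℝ] ℝ, (∀ (z : ℂ) (r : ℝ), f (z * r) = f z * r) →
      ∀ e, f (Q.coeff e) = 0 := by
    intro f hf
    set Qf : MvPolynomial σ ℝ := ∑ e ∈ Q.support, monomial e (f (Q.coeff e)) with hQf
    have hevalR : ∀ x : σ → ℝ,
        MvPolynomial.eval x Qf = ∑ e ∈ Q.support, f (Q.coeff e) * e.prod fun i n => x i ^ n := by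
      intro x
      rw [hQf, map_sum]
      simp only [eval_monomial]
    have hQf0 : Qf = 0 := MvPolynomial.funext fun x => by
      rw [hevalR, map_zero]
      have := congrArg f (h x)
      rw [hevalC, map_sum, map_zero] at this
      simpa only [hf] using this
    intro e
    by_cases he : e ∈ Q.support
    · have := congrArg (coeff e) hQf0
      rw [hQf, coeff_sum, coeff_zero] at this
      simpa [coeff_monomial, he] using this
    · rw [notMem_support_iff.mp he, map_zero]
  ext e
  rw [coeff_zero]
  apply Complex.ext
  · simpa using hpart Complex.reLm (fun z r => by simp [Complex.mul_re]) e
  · simpa using hpart Complex.imLm (fun z r => by simp [Complex.mul_im]) e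

/-- Two complex polynomials taking the same values at all real points are equal. [folklore] -/
theorem eq_of_forall_eval_ofReal_eq {σ : Type} (Q R : MvPolynomial σ ℂ)
    (h : ∀ x : σ → ℝ, MvPolynomial.eval (fun i => (x i : ℂ)) Q =
      MvPolynomial.eval (fun i => (x i : ℂ)) R) : Q = R := by
  rw [← sub_eq_zero]
  exact eq_zero_of_forall_eval_ofReal_eq_zero _ fun x => by rw [map_sub, h x, sub_self]

/-- Coefficient form: a complex polynomial vanishing at all real points has all coefficients
zero. [folklore] -/
theorem coeff_eq_zero_of_forall_eval_ofReal_eq_zero {σ : Type} (Q : MvPolynomial σ ℂ)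
    (h : ∀ x : σ → ℝ, MvPolynomial.eval (fun i => (x i : ℂ)) Q = 0) (e : σ →₀ ℕ) :
    Q.coeff e = 0 := by
  rw [eq_zero_of_forall_eval_ofReal_eq_zero Q h, coeff_zero]

end RealPoints

end Summit.AnomalousDissipation.AnomalousDissipation.Theorems.MomentParityQuarticGate
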